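import Summits.QuantumFields.YangMills.Theorems.UnitScaleTiltProp8FlatPortKernelRows
import HarnessLib

/-!
# K0⁷ `stub_prop8StepCoP13` (stmt-QuantumFields-20541), S5 ROAD item (b) — the d-generic port, file P7a: **THE THREE `D`-FREE BUDGETS OF THE ASSEMBLY AT GENERAL
# DIMENSION** — carrier-generic twins of `UnitScaleTiltProp8FlatPortKernelRows.theta_budget ∕ absorb_budget ∕ chart_params` (the d = 3 file writes the dimension as
# `2 + 1`; here `d + 1`, proofs VERBATIM after the substitution)

Cell `pub-ymgap`, width seat `pub-ymgap-k0-s1-w3` gen 2 (D-0149; START LIST v7 §k0-s1 S5 ROAD item (b)).  `--kind proof --supports stmt-QuantumFields-20541 --as helper`;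
count-neutral; def-free; nothing of Bałaban's analysis asserted (real-number bookkeeping only).  HONEST FRAMING: K0⁷ OPEN; N07 NOT discharged (5∕27 unmoved); R4 closes the
conditional finite-𝕋⁴ rung `BalabanLadder.UV` only — the YM mass gap (Clay) is NOT proved by any of this; nothing continuum ∕ ℝ⁴ ∕ OS.

References: T. Bałaban, CMP **96** (1984) 223–250 [Balaban1984PropagatorsII] (2.1) p.224, (2.59) p.233, (2.88) p.238.
-/

set_option autoImplicit false

noncomputable section

namespace Summit.QuantumFields.YangMills.Theorems.K0FlatPortBudgetsP

open Literature.MathematicalPhysics.QuantumFieldTheory.Balaban1983to89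
open B6MultiLevelBoxOperator (N0)
open B6GlobalChartV1 (PV)
open B6Ineq261LevelGap (theta_lt_one_of_log)
open B6Cor28KLevelV1 (absorb_threshold)

/-- the Lemma-2.1 budget for a rate `s > 0` at dimension `d + 1`: `N(s) := ⌈2(d+1)·log L / s⌉₊ + 1` satisfies the (2.59)-shape threshold `e^{−s}·L^{2(d+1)/N} < 1`.
[cite: Balaban1984PropagatorsII, (2.59) p.233] -/
theorem theta_budget (d ℓ : ℕ) {s : ℝ} (hs : 0 < s) :
    0 < ⌈2 * ((d + 1 : ℕ) : ℝ) * Real.log ((ℓ : ℝ) + 1) / s⌉₊ + 1 ∧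
    Real.exp (-s) * ((ℓ : ℝ) + 1) ^ ((2 * (d + 1 : ℕ) : ℝ) / (⌈2 * ((d + 1 : ℕ) : ℝ) * Real.log ((ℓ : ℝ) + 1) / s⌉₊ + 1 : ℕ)) < 1 := by
  have hL0 : (0 : ℝ) < (ℓ : ℝ) + 1 := by positivity
  refine ⟨Nat.succ_pos _, theta_lt_one_of_log hL0 (Nat.succ_pos _) ?_⟩
  have h1 : 2 * ((d + 1 : ℕ) : ℝ) * Real.log ((ℓ : ℝ) + 1) / s ≤ (⌈2 * ((d + 1 : ℕ) : ℝ) * Real.log ((ℓ : ℝ) + 1) / s⌉₊ : ℝ) := Nat.le_ceil _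
  rw [div_le_iff₀ hs] at h1
  push_cast at h1 ⊢
  nlinarith [Real.log_nonneg (by linarith : (1 : ℝ) ≤ (ℓ : ℝ) + 1), (Nat.cast_nonneg d : (0 : ℝ) ≤ d)]

/-- the absorption budget for a rate `δ > 0` at dimension `d + 1`: with `N₃(δ) := ⌈2(d+3)·L/δ⌉₊`, `N₃ + 1 ≤ R·L·M_h` gives `L^{d+3}·e^{−(δ/2)(R·L·M_h − 1)} ≤ 1`, hence the `L³` and
`L¹` forms. [cite: Balaban1984PropagatorsII, (2.59) p.233, (2.88) p.238, bookkeeping] -/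
theorem absorb_budget (d ℓ : ℕ) {δ : ℝ} (hδ : 0 < δ) {R Mh : ℕ} (hRM : ⌈2 * ((d : ℝ) + 3) * ((ℓ : ℝ) + 1) / δ⌉₊ + 1 ≤ R * ((ℓ + 1) * Mh)) :
    ((ℓ : ℝ) + 1) ^ (d + 3) * Real.exp (-(δ / 2 * ((R : ℝ) * (((ℓ : ℝ) + 1) * Mh) - 1))) ≤ 1 ∧
    ((ℓ : ℝ) + 1) ^ 3 * Real.exp (-(δ / 2 * ((R : ℝ) * (((ℓ : ℝ) + 1) * Mh) - 1))) ≤ 1 ∧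
    ((ℓ : ℝ) + 1) ^ 1 * Real.exp (-(δ / 2 * ((R : ℝ) * (((ℓ : ℝ) + 1) * Mh) - 1))) ≤ 1 := by
  have hL1 : (1 : ℝ) ≤ (ℓ : ℝ) + 1 := by linarith [(Nat.cast_nonneg ℓ : (0 : ℝ) ≤ ℓ)]
  have hN₃ : 2 * (((d : ℕ) : ℝ) + 3) * ((ℓ : ℝ) + 1) ≤ δ * (⌈2 * ((d : ℝ) + 3) * ((ℓ : ℝ) + 1) / δ⌉₊ : ℝ) := by
    have h1 : 2 * ((d : ℝ) + 3) * ((ℓ : ℝ) + 1) / δ ≤ (⌈2 * ((d : ℝ) + 3) * ((ℓ : ℝ) + 1) / δ⌉₊ : ℝ) := Nat.le_ceil _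
    rw [div_le_iff₀ hδ] at h1
    linarith
  have hN : ((⌈2 * ((d : ℝ) + 3) * ((ℓ : ℝ) + 1) / δ⌉₊ : ℕ) : ℝ) ≤ (R : ℝ) * (((ℓ : ℝ) + 1) * Mh) - 1 := by
    have h1 := (Nat.cast_le (α := ℝ)).mpr hRM
    push_cast at h1
    linarith
  have h5 : ((ℓ : ℝ) + 1) ^ (d + 3) * Real.exp (-(δ / 2 * ((R : ℝ) * (((ℓ : ℝ) + 1) * Mh) - 1))) ≤ 1 := absorb_threshold (d := d) hδ hN₃ hN
  have hE : 0 ≤ Real.exp (-(δ / 2 * ((R : ℝ) * (((ℓ : ℝ) + 1) * Mh) - 1))) := (Real.exp_pos _).le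
  refine ⟨h5, le_trans (mul_le_mul_of_nonneg_right (pow_le_pow_right₀ hL1 (by omega)) hE) h5,
    le_trans (mul_le_mul_of_nonneg_right (pow_le_pow_right₀ hL1 (by omega)) hE) h5⟩

/-- the chart parameters of an `Adm22` family with big blocks `M = L·M_h`, `M_h = L^{a′}`, on the carrier torus `2L^{m+K}` (any dimension `d + 1`): `P′ = 2L^{m+n−1−a′}`,
`P″ = 2L^{m+n−2−a′}` (`a′ + 3 ≤ m + n`: at least `5L` big blocks per direction at level `K − n`). [cite: Balaban1984PropagatorsII, (2.1) p.224, dictionary] -/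
theorem chart_params (d ℓ m n K a' : ℕ) (hd : 1 ≤ d + 1) (hL : Odd (ℓ + 1) ∧ 1 < ℓ + 1) (hℓ : 4 ≤ ℓ) (hnK : 1 ≤ K - n) (hsize : a' + 3 ≤ m + n) :
    (∀ μ : Fin (d + 1), N0 ℓ ((ℓ + 1) ^ a') (K - n) (fun _ => 2 * (ℓ + 1) ^ (m + n - 1 - a')) μ = (PV d ℓ m K hd hL).sitesPerDir 0) ∧
    (∀ μ : Fin (d + 1), (fun _ : Fin (d + 1) => 2 * (ℓ + 1) ^ (m + n - 1 - a')) μ = (ℓ + 1) * (fun _ : Fin (d + 1) => 2 * (ℓ + 1) ^ (m + n - 2 - a')) μ) ∧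
    (∀ μ : Fin (d + 1), 5 ≤ (fun _ : Fin (d + 1) => 2 * (ℓ + 1) ^ (m + n - 2 - a')) μ) := by
  refine ⟨fun μ => ?_, fun μ => ?_, fun μ => ?_⟩
  · show (ℓ + 1) ^ (K - n) * ((ℓ + 1) * ((ℓ + 1) ^ a' * (2 * (ℓ + 1) ^ (m + n - 1 - a')))) = 2 * (ℓ + 1) ^ (m + K - 0)
    have e : m + K - 0 = (K - n) + 1 + a' + (m + n - 1 - a') := by omega
    rw [e, pow_add, pow_add, pow_add, pow_one]; ring
  · show 2 * (ℓ + 1) ^ (m + n - 1 - a') = (ℓ + 1) * (2 * (ℓ + 1) ^ (m + n - 2 - a'))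
    have e : m + n - 1 - a' = (m + n - 2 - a') + 1 := by omega
    rw [e, pow_succ]; ring
  · show 5 ≤ 2 * (ℓ + 1) ^ (m + n - 2 - a')
    have h1 : 1 ≤ m + n - 2 - a' := by omega
    have h2 : (ℓ + 1) ^ 1 ≤ (ℓ + 1) ^ (m + n - 2 - a') := Nat.pow_le_pow_right (Nat.succ_pos ℓ) h1
    rw [pow_one] at h2
    omega

end Summit.QuantumFields.YangMills.Theorems.K0FlatPortBudgetsP

end
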